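import Summits.BirchSwinnertonDyer.BirchSwinnertonDyer.Theorems.GenusKolyvaginAtTwoPowDvdShaCardAtTwoRTLocalKernelQuadraticDescent
import Mathlib.FieldTheory.Minpoly.Field
import HarnessLib

/-!
# Route `GenusKolyvaginAtTwo`, LINE 18 / LINE 19 (stmt-BirchSwinnertonDyer-23242 / -23379), around the local lemma `W_{v,K} = 0`:
# `2`-TORSION DOES NOT APPEAR IN A QUADRATIC EXTENSION — `E(F)[2] = 0 ⟹ E(L)[2] = 0` for `[L : F] = 2`, and the `ℚ_v`-side form of
# `localKernel_eq_bot_of_finrank_eq_two_of_forall_two_smul`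

Seat `bsd-line-gk2-p3` g16 (cell `bsd-f1-sign2`), `--supports stmt-BirchSwinnertonDyer-23242` (helper; closes nothing).  THEOREMS ONLY;
BSD is not proved by any of this.

A `2`-torsion point `(x, y)` of a Weierstrass curve over a field of characteristic `≠ 2` has `x` a root of the `2`-division cubic
`4X³ + b₂X² + 2b₄X + b₆`; if `x` lies in a quadratic extension `L` of `F`, the minimal polynomial of `x` has degree `≤ 2`, so the
cubic has a linear factor over `F`, i.e. a root `a ∈ F`, and `(a, −(a₁a + a₃)/2)` is a `2`-torsion point over `F`.  Hence
`E(F)[2] = 0 ⟹ E(L)[2] = 0` for EVERY quadratic `L/F` (no hypothesis on `L`: this removes the Heegner / odd-`d_K` binders of the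
habitat lemma `CMExactDescent.eq_zero_of_two_smul_eq_zero_baseChange`, and turns the hypothesis `E(K_w)[2] = 0` of this seat's
`localKernel_eq_bot_of_finrank_eq_two_of_forall_two_smul` into `E(ℚ_v)[2] = 0`).

* `two_smul_eq_zero_iff_of_some` — `2 • (x, y) = 0 ↔ y = negY x y`; `fourCubic_eq_zero_of_two_smul_eq_zero` — then
  `4x³ + b₂x² + 2b₄x + b₆ = 0` (`2 ≠ 0` not needed for this direction).
* `exists_two_torsion_of_root` — a root `a ∈ F` of the cubic gives `P ≠ 0` with `2 • P = 0` (`2 ≠ 0` in `F`, `W` elliptic).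
* `forall_two_smul_eq_zero_baseChange_of_finrank_eq_two` — **`E(F)[2] = 0 ⟹ E(L)[2] = 0` for `[L : F] = 2`**.
* `localKernel_eq_bot_of_finrank_eq_two_of_forall_two_smul_rat` — `W_{v,K} = 0` at a quadratic place `w ∣ v ∤ 2` when
  `E(ℚ_v)[2] = 0` (e.g. a good odd `v = p` with `a_p(E)` odd).

References: [SilvermanAEC2009] III.2.3 (duplication / `2`-torsion), VIII.§1; [Kramer1981] §2 Prop. 3.
-/

set_option autoImplicit false
-- the Theorems namespace of this sub repeats the summit name by design (D-0017 nested layout)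
set_option linter.dupNamespace false

noncomputable section

open scoped Classical

namespace Summit.BirchSwinnertonDyer.BirchSwinnertonDyer.Theorems.GenusExact.PlusDescent

open WeierstrassCurve Polynomial

universe u

/-! ## §1 `2`-torsion points and the `2`-division cubic -/

section Cubic

variable {F : Type u} [Field F] (W : WeierstrassCurve F)

/-- **`2 • (x, y) = 0 ↔ y = negY x y`** (`P = -P`). [cite: SilvermanAEC2009, III.2.3] -/
theorem two_smul_eq_zero_iff_of_some {x y : F} (h : W.toAffine.Nonsingular x y) :
    (2 : ℕ) • (WeierstrassCurve.Affine.Point.some x y h) = 0 ↔ y = W.toAffine.negY x y := by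
  rw [two_nsmul, add_eq_zero_iff_eq_neg, WeierstrassCurve.Affine.Point.neg_some]
  constructor
  · intro hP
    exact (WeierstrassCurve.Affine.Point.some.inj hP).2
  · intro hy
    exact (WeierstrassCurve.Affine.Point.some.injEq ..).mpr ⟨rfl, hy⟩

/-- **The `x`-coordinate of a `2`-torsion point is a root of `4X³ + b₂X² + 2b₄X + b₆`**: on the curve
`(2y + a₁x + a₃)² = 4x³ + b₂x² + 2b₄x + b₆`, and `2 • (x, y) = 0` means `2y + a₁x + a₃ = 0`. [cite: SilvermanAEC2009, III.2.3] -/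
theorem fourCubic_eq_zero_of_two_smul_eq_zero {x y : F} (h : W.toAffine.Nonsingular x y)
    (hP : (2 : ℕ) • (WeierstrassCurve.Affine.Point.some x y h) = 0) :
    4 * x ^ 3 + W.b₂ * x ^ 2 + 2 * W.b₄ * x + W.b₆ = 0 := by
  have hy : y = W.toAffine.negY x y := (two_smul_eq_zero_iff_of_some W h).mp hP
  have heq : y ^ 2 + W.a₁ * x * y + W.a₃ * y = x ^ 3 + W.a₂ * x ^ 2 + W.a₄ * x + W.a₆ :=
    (WeierstrassCurve.Affine.equation_iff ..).mp h.1
  simp only [WeierstrassCurve.Affine.negY] at hy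
  have h2y : 2 * y + W.a₁ * x + W.a₃ = 0 := by linear_combination hy
  simp only [WeierstrassCurve.b₂, WeierstrassCurve.b₄, WeierstrassCurve.b₆]
  linear_combination (2 * y + W.a₁ * x + W.a₃) * h2y - 4 * heq

/-- **A root `a ∈ F` of `4X³ + b₂X² + 2b₄X + b₆` gives a non-zero `2`-torsion point `(a, −(a₁a + a₃)/2) ∈ E(F)`**
(`2 ≠ 0` in `F`; `W` elliptic, so every point of the curve is nonsingular). [cite: SilvermanAEC2009, III.2.3] -/
theorem exists_two_torsion_of_root [W.IsElliptic] (h2 : (2 : F) ≠ 0) {a : F}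
    (ha : 4 * a ^ 3 + W.b₂ * a ^ 2 + 2 * W.b₄ * a + W.b₆ = 0) :
    ∃ P : W.toAffine.Point, P ≠ 0 ∧ (2 : ℕ) • P = 0 := by
  set b : F := -(W.a₁ * a + W.a₃) / 2 with hb
  have h2b : 2 * b + W.a₁ * a + W.a₃ = 0 := by
    rw [hb]; field_simp; ring
  have heq : W.toAffine.Equation a b := by
    rw [WeierstrassCurve.Affine.equation_iff]
    simp only [WeierstrassCurve.b₂, WeierstrassCurve.b₄, WeierstrassCurve.b₆] at ha
    have h4 : (4 : F) ≠ 0 := by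
      have : (4 : F) = 2 * 2 := by norm_num
      rw [this]; exact mul_ne_zero h2 h2
    apply mul_left_cancel₀ h4
    linear_combination (2 * b + W.a₁ * a + W.a₃) * h2b - ha
  have hns : W.toAffine.Nonsingular a b := (WeierstrassCurve.Affine.equation_iff_nonsingular ..).mp heq
  refine ⟨WeierstrassCurve.Affine.Point.some a b hns, WeierstrassCurve.Affine.Point.some_ne_zero hns, ?_⟩
  rw [two_smul_eq_zero_iff_of_some W hns]
  simp only [WeierstrassCurve.Affine.negY]
  linear_combination h2b

end Cubic

/-! ## §2 No new `2`-torsion in a quadratic extension -/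

section Quadratic

variable {F : Type u} [Field F] (W : WeierstrassCurve F) (L : Type u) [Field L] [Algebra F L]

/-- **`E(F)[2] = 0 ⟹ E(L)[2] = 0` for a quadratic extension `L/F`** (`2 ≠ 0` in `F`, `W` elliptic): the `x`-coordinate of a
`2`-torsion point over `L` is a root of the `2`-division cubic of `W`, of degree `≤ 2` over `F`, so the cubic acquires a root in
`F` (it IS in `F`, or its minimal polynomial is a quadratic factor leaving a linear one), whence a `2`-torsion point over `F`.
[cite: SilvermanAEC2009, III.2.3 and VIII.§1] -/
theorem forall_two_smul_eq_zero_baseChange_of_finrank_eq_two [W.IsElliptic] [FiniteDimensional F L]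
    (hL : Module.finrank F L = 2) (h2 : (2 : F) ≠ 0)
    (hF : ∀ P : W.toAffine.Point, (2 : ℕ) • P = 0 → P = 0)
    (P : (W.baseChange L).toAffine.Point) (hP : (2 : ℕ) • P = 0) : P = 0 := by
  rcases P with _ | ⟨x, y, h⟩
  · rfl
  · exfalso
    haveI : (W.baseChange L).IsElliptic := by rw [WeierstrassCurve.baseChange]; infer_instance
    -- `x` is a root of the `2`-division cubic of `W` (coefficients in `F`)
    have hx := fourCubic_eq_zero_of_two_smul_eq_zero (W.baseChange L) h hP
    simp only [WeierstrassCurve.baseChange, WeierstrassCurve.map_b₂, WeierstrassCurve.map_b₄, WeierstrassCurve.map_b₆] at hx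
    set f : F[X] := C 4 * X ^ 3 + C W.b₂ * X ^ 2 + C (2 * W.b₄) * X + C W.b₆ with hf
    have hfx : aeval x f = 0 := by
      rw [hf]
      simp only [map_add, map_mul, aeval_C, aeval_X, map_pow, map_ofNat]
      linear_combination hx
    -- a root `a ∈ F` of `f` contradicts `E(F)[2] = 0`
    have key : ∀ a : F, f.IsRoot a → False := by
      intro a ha
      have ha' : 4 * a ^ 3 + W.b₂ * a ^ 2 + 2 * W.b₄ * a + W.b₆ = 0 := by
        rw [hf] at ha
        simpa only [IsRoot.def, eval_add, eval_mul, eval_C, eval_X, eval_pow] using ha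
      obtain ⟨P₀, hP₀, h2P₀⟩ := exists_two_torsion_of_root W h2 ha'
      exact hP₀ (hF P₀ h2P₀)
    have h4 : (4 : F) ≠ 0 := by
      have : (4 : F) = 2 * 2 := by norm_num
      rw [this]; exact mul_ne_zero h2 h2
    have hfdeg : f.natDegree = 3 := by
      rw [hf]; compute_degree!
    have hf0 : f ≠ 0 := by
      intro h0; rw [h0, natDegree_zero] at hfdeg; exact absurd hfdeg (by norm_num)
    -- the minimal polynomial of `x` divides `f` and has degree `1` or `2`
    have hxint : IsIntegral F x := Algebra.IsIntegral.isIntegral x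
    have hdvd : minpoly F x ∣ f := minpoly.dvd F x hfx
    have hdeg_le : (minpoly F x).natDegree ≤ 2 := hL ▸ minpoly.natDegree_le x
    have hdeg_pos : 0 < (minpoly F x).natDegree := minpoly.natDegree_pos hxint
    obtain ⟨g, hg⟩ := hdvd
    have hg0 : g ≠ 0 := by
      intro h0; rw [h0, mul_zero] at hg; exact hf0 hg
    have hdegsum : f.natDegree = (minpoly F x).natDegree + g.natDegree := by
      rw [hg, natDegree_mul (minpoly.ne_zero hxint) hg0]
    rw [hfdeg] at hdegsum
    rcases Nat.lt_or_ge (minpoly F x).natDegree 2 with hlt | hge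
    · -- degree `1`: `x ∈ F`, a root of `f` in `F`
      have h1 : (minpoly F x).degree = 1 := by
        rw [degree_eq_natDegree (minpoly.ne_zero hxint)]
        have : (minpoly F x).natDegree = 1 := by omega
        rw [this]; rfl
      obtain ⟨a, ha⟩ := minpoly.mem_range_of_degree_eq_one F x h1
      apply key a
      have h' := hfx
      rw [← ha, aeval_algebraMap_apply_eq_algebraMap_eval, map_eq_zero_iff _ (algebraMap F L).injective] at h'
      exact h'
    · -- degree `2`: the cofactor `g` is linear and has a root in `F`
      have hgdeg : g.natDegree = 1 := by omega
      have hgdeg' : g.degree = 1 := by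
        rw [degree_eq_natDegree hg0, hgdeg]; rfl
      obtain ⟨a, ha⟩ := exists_root_of_degree_eq_one hgdeg'
      apply key a
      rw [IsRoot.def, hg, eval_mul, ha.eq_zero, mul_zero]

end Quadratic

/-! ## §3 `W_{v,K} = 0` with the hypothesis on `E(ℚ_v)` -/

section Local

open NumberField IsDedekindDomain Literature.NumberTheory.EllipticCurves Literature.Barriers.BirchSwinnertonDyer

/-- **`W_{v,K} = 0` at a quadratic place `w ∣ v ∤ 2` with `E(ℚ_v)[2] = 0`** (e.g. `v = p` an odd prime of good reduction with
`a_p(E)` odd): `E(ℚ_v)[2] = 0 ⟹ E(K_w)[2] = 0` (`forall_two_smul_eq_zero_baseChange_of_finrank_eq_two`) and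
`localKernel_eq_bot_of_finrank_eq_two_of_forall_two_smul`. [cite: Kramer1981, §2 Prop. 3] [cite: Matsuno2009, §3 (p. 451, W_{v,K})] -/
theorem localKernel_eq_bot_of_finrank_eq_two_of_forall_two_smul_rat (E : WeierstrassCurve ℚ) [E.IsElliptic]
    (K : Type) [Field K] [NumberField K] (v : HeightOneSpectrum (𝓞 ℚ)) (w : HeightOneSpectrum (𝓞 K))
    [w.asIdeal.LiesOver v.asIdeal]
    (h2 : letI : Algebra (v.adicCompletion ℚ) (w.adicCompletion K) :=
        (Literature.NumberTheory.EllipticCurves.adicCompletionMap (K := ℚ) K v w).toAlgebra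
      Module.finrank (v.adicCompletion ℚ) (w.adicCompletion K) = 2)
    (hw : ((2 : ℕ) : 𝓞 K) ∉ w.asIdeal)
    (htors : ∀ P : (E.baseChange (v.adicCompletion ℚ)).toAffine.Point, (2 : ℕ) • P = 0 → P = 0) :
    Matsuno2009.localKernel E K v w = ⊥ := by
  letI instQv : Algebra ℚ (v.adicCompletion ℚ) :=
    IsDedekindDomain.HeightOneSpectrum.instAlgebraAdicCompletion (𝓞 ℚ) ℚ v
  letI : Algebra (v.adicCompletion ℚ) (w.adicCompletion K) :=
    (Literature.NumberTheory.EllipticCurves.adicCompletionMap (K := ℚ) K v w).toAlgebra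
  haveI : IsScalarTower ℚ (v.adicCompletion ℚ) (w.adicCompletion K) :=
    IsScalarTower.of_algebraMap_eq fun x ↦
      (Literature.NumberTheory.EllipticCurves.adicCompletionMap_coe (K := ℚ) K v w x).symm
  haveI : IsScalarTower ℚ K (w.adicCompletion K) := IsScalarTower.of_algebraMap_eq fun x ↦
    (IsScalarTower.algebraMap_apply ℚ K (w.adicCompletion K) x)
  haveI : CharZero (v.adicCompletion ℚ) :=
    charZero_of_injective_algebraMap (algebraMap ℚ (v.adicCompletion ℚ)).injective
  haveI : FiniteDimensional (v.adicCompletion ℚ) (w.adicCompletion K) := Module.finite_of_finrank_eq_succ h2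
  haveI : (E.baseChange (v.adicCompletion ℚ)).IsElliptic := by rw [WeierstrassCurve.baseChange]; infer_instance
  have h2v : (2 : v.adicCompletion ℚ) ≠ 0 := two_ne_zero
  -- `E(K_w)[2] = 0` in the model `(E_{ℚ_v})_{K_w}`, then transported to `(E_K)_{K_w}`
  have hL : ∀ P : ((E.baseChange (v.adicCompletion ℚ)).baseChange (w.adicCompletion K)).toAffine.Point,
      (2 : ℕ) • P = 0 → P = 0 :=
    forall_two_smul_eq_zero_baseChange_of_finrank_eq_two (E.baseChange (v.adicCompletion ℚ)) (w.adicCompletion K)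
      h2 h2v htors
  let c : ((E.baseChange K).baseChange (w.adicCompletion K)).toAffine.Point ≃+
      ((E.baseChange (v.adicCompletion ℚ)).baseChange (w.adicCompletion K)).toAffine.Point :=
    (pointsCongr E K (w.adicCompletion K)).symm.trans (pointsCongr E (v.adicCompletion ℚ) (w.adicCompletion K))
  refine localKernel_eq_bot_of_finrank_eq_two_of_forall_two_smul E K v w h2 hw fun P hP ↦ ?_
  have h' : (2 : ℕ) • c P = 0 := by rw [← map_nsmul, hP, map_zero]
  exact (map_eq_zero_iff c c.injective).mp (hL (c P) h')

end Local

end Summit.BirchSwinnertonDyer.BirchSwinnertonDyer.Theorems.GenusExact.PlusDescent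

end
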